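import Mathlib
import Summits.NavierStokesRegularity.NavierStokesRegularity.Theorems.FilamentSkeletonRssDefectColumnGateAzimuthalBlockTwoZoneConstants
import Summits.NavierStokesRegularity.NavierStokesRegularity.Theorems.FilamentSkeletonRssDefectColumnGateAzimuthalBlockTwoZoneAbsorb

/-!
# Route `FilamentSkeletonRss` · crux `TransverseReduction1AG` (stmt-NavierStokesRegularity-27853; A1L twin stmt-23297) · line
# `defect_column_gate_1AG/1AL` — the PACKAGED m-block resolvent bound with polynomial loss (symmetric column, BS-coupled azimuthal blocks `m ≥ 2`)

Helper file (`--supports stmt-NavierStokesRegularity-27853 --as helper`; seat ns-filament-s2aloc-p1 g2; note ARCHITECTURE-B2B3-s2aloc-g2.md v6 §8).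

`twoZone_resolvent_bound` — the deliverable of MINT req187's no-hit branch for the blocks `m ≥ 2` of the symmetric column, in the 1-D dictionary
`u = r²` of LEAD's radial block: for `0 < γ`, `2 ≤ m` there are `R₀ ≥ 1` and `C ≥ 0` (depending on `γ, m` only) such that for every `Rc ≥ R₀`, every
rotation offset `ρ` with `40π|ρ|((12/γ)log Rc + 6/γ) ≤ Rc`, every support radius `U ≥ (12/γ)log Rc + 3/γ` and every Biot–Savart-coupled azimuthal
block `(a, b; φa, φb)` (LEAD-style hypotheses on `(0,∞)`, support `[0,U]`, data `(1+u)²|f_i| ≤ M`):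
`∀ u ∈ [0,U], (1+u)⁴(a(u)² + b(u)²) ≤ C·(1 + log Rc)¹¹·Rc³·M²` — loss polynomial in `Rc` (`Rc³log¹¹Rc`), UNIFORM in the support radius `U = R²`.
(Support radii `U < (12/γ)log Rc + 3/γ` are covered directly by the pure Gaussian-core bound `coreGauss_sup_sq_le`, p675134, with `e^{γU/4} ≤ e^{3/4}Rc³`.)
PROOF: `twoZone_loop_large_three` (inner radius `u₀ = (12/γ)log Rc`, `e^{γu₀/4} = Rc³`, loop smallness) → `twoZone_loop_reduction` (`θ′` choice, loop
inequality) → `twoZone_sup_le` (the two-zone theorem) with the source size `N := √S`, `S = max_{[0,U]}(1+u)⁴(a²+b²)` → `twoZone_constants_le`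
(`≤ K_c(1+u₀)¹¹Rc³M_E²`) → `M_E² ≤ 2M² + 2g²N²` and `twoZone_absorb_small` (`2K_c(1+u₀)¹¹Rc³g² ≤ ½`) → `S ≤ 4K_c(1+u₀)¹¹Rc³M²`.
HONEST FRAMING: an a-priori (resolvent) bound for ONE family of blocks (`m ≥ 2`, symmetric column; not `m = 0, 1`, not the strain/tilt couplings, not
the axial variable) of ONE linear MODEL operator of a hypothetical blow-up route (MODEL rung, negative side); `WaistColumnGateLoc1A`,
`TransverseReduction1AG/1AL` are neither proved nor refuted; nothing here bears on NS regularity.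
-/

set_option linter.dupNamespace false

noncomputable section

namespace Summit.NavierStokesRegularity.NavierStokesRegularity.Theorems.DefectColumnGate

open Set MeasureTheory intervalIntegral

/-- The source size from the weighted sup: if `(1+u)⁴w(u)² ≤ S` on `[0,U]` and `w = 0` beyond `U`, then `u|w(u)| ≤ √S` for `u > 0`. -/
theorem source_le_sqrt_sup {U S : ℝ} {w : ℝ → ℝ} (hS : ∀ u ∈ Icc 0 U, (1 + u) ^ 4 * w u ^ 2 ≤ S) (hw0 : ∀ u, U ≤ u → w u = 0) :
    ∀ u, 0 < u → u * |w u| ≤ Real.sqrt S := by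
  intro u hu
  rcases le_or_gt u U with hle | hgt
  · have h1 := hS u ⟨hu.le, hle⟩
    have h3a : u ≤ (1 + u) ^ 2 := by nlinarith only [hu]
    have h3 : u ^ 2 ≤ (1 + u) ^ 4 := by
      have := pow_le_pow_left₀ hu.le h3a 2
      have e : ((1 + u) ^ 2) ^ 2 = (1 + u) ^ 4 := by ring
      rw [e] at this; exact this
    have h2 : (u * |w u|) ^ 2 ≤ S := by
      have h4 : (u * |w u|) ^ 2 = u ^ 2 * w u ^ 2 := by rw [mul_pow, sq_abs]
      rw [h4]
      have := mul_le_mul_of_nonneg_right h3 (sq_nonneg (w u))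
      linarith only [this, h1]
    have h5 : u * |w u| = Real.sqrt ((u * |w u|) ^ 2) := (Real.sqrt_sq (by positivity)).symm
    rw [h5]; exact Real.sqrt_le_sqrt h2
  · rw [hw0 u hgt.le, abs_zero, mul_zero]; exact Real.sqrt_nonneg _

/-- **m-block resolvent bound with polynomial loss (symmetric column, Biot–Savart-coupled azimuthal blocks `m ≥ 2`).**  See the module docstring. -/
theorem twoZone_resolvent_bound {γ m : ℝ} (hγ : 0 < γ) (hm : 2 ≤ m) :
    ∃ R₀ C : ℝ, 1 ≤ R₀ ∧ 0 ≤ C ∧ ∀ (Rc ρ U M : ℝ) (a a₁ b b₁ φa φa₁ φb φb₁ f₁ f₂ : ℝ → ℝ),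
      R₀ ≤ Rc →
      12 / γ * Real.log Rc + 3 / γ ≤ U →
      40 * Real.pi * |ρ| * ((12 / γ * Real.log Rc) + 6 / γ) ≤ Rc →
      ContinuousOn a (Ici 0) →
      ContinuousOn b (Ici 0) →
      ContinuousOn a₁ (Ioi 0) →
      ContinuousOn b₁ (Ioi 0) →
      ContinuousOn φa (Ici 0) →
      ContinuousOn φb (Ici 0) →
      ContinuousOn f₁ (Ici 0) →
      ContinuousOn f₂ (Ici 0) →
      ContinuousOn (fun s => 4 * s * a₁ s + γ * s * a s) (Ici 0) →
      ContinuousOn (fun s => 4 * s * b₁ s + γ * s * b s) (Ici 0) →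
      ContinuousOn (fun s => s * φa₁ s) (Ici 0) →
      ContinuousOn (fun s => s * φb₁ s) (Ici 0) →
      a 0 = 0 →
      b 0 = 0 →
      φa 0 = 0 →
      φb 0 = 0 →
      (∀ u, 0 < u → HasDerivAt a (a₁ u) u) →
      (∀ u, 0 < u → HasDerivAt b (b₁ u) u) →
      (∀ u, 0 < u → HasDerivAt φa (φa₁ u) u) →
      (∀ u, 0 < u → HasDerivAt φb (φb₁ u) u) →
      (∀ u, 0 < u → HasDerivAt (fun s => 4 * s * a₁ s + γ * s * a s)
        (m ^ 2 / u * a u - m * (ρ + Rc * ((1 - Real.exp (-(γ * u / 4))) / (2 * Real.pi * u))) * b u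
          + γ * m * Rc / 2 * (γ / (4 * Real.pi) * Real.exp (-(γ * u / 4))) * φb u - f₁ u) u) →
      (∀ u, 0 < u → HasDerivAt (fun s => 4 * s * b₁ s + γ * s * b s)
        (m ^ 2 / u * b u + m * (ρ + Rc * ((1 - Real.exp (-(γ * u / 4))) / (2 * Real.pi * u))) * a u
          - γ * m * Rc / 2 * (γ / (4 * Real.pi) * Real.exp (-(γ * u / 4))) * φa u - f₂ u) u) →
      (∀ u, 0 < u → HasDerivAt (fun s => s * φa₁ s) ((m ^ 2 / u * φa u - a u) / 4) u) →
      (∀ u, 0 < u → HasDerivAt (fun s => s * φb₁ s) ((m ^ 2 / u * φb u - b u) / 4) u) →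
      (∀ u, U ≤ u → a u = 0) →
      (∀ u, U ≤ u → b u = 0) →
      (∀ u, U ≤ u → φa u = 0) →
      (∀ u, U ≤ u → φb u = 0) →
      (∀ u, 0 ≤ u → (1 + u) ^ 2 * |f₁ u| ≤ M) →
      (∀ u, 0 ≤ u → (1 + u) ^ 2 * |f₂ u| ≤ M) →
      IntervalIntegrable (fun u => Real.exp (γ * u / 4)
        * ((1 - Real.exp (-(γ * u / 4))) / (2 * Real.pi * u)) * (a u ^ 2 + b u ^ 2)) volume 0 U →
      IntervalIntegrable (fun u => Real.exp (γ * u / 4) * (a u ^ 2 + b u ^ 2)) volume 0 U →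
      IntervalIntegrable (fun u => Real.exp (γ * u / 4) * (a u * f₂ u - b u * f₁ u)) volume 0 U →
      IntervalIntegrable (fun u => Real.exp (γ * u / 4) * (a u * f₁ u + b u * f₂ u)) volume 0 U →
      IntervalIntegrable (fun u => Real.exp (γ * u / 4) * (4 * u * (a₁ u ^ 2 + b₁ u ^ 2))) volume 0 U →
      IntervalIntegrable (fun u => Real.exp (γ * u / 4) * (m ^ 2 / u * (a u ^ 2 + b u ^ 2))) volume 0 U →
      IntervalIntegrable (fun u => a u * φa u) volume 0 U →
      IntervalIntegrable (fun u => b u * φb u) volume 0 U →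
      IntervalIntegrable (fun u => 4 * u * φa₁ u ^ 2) volume 0 U →
      IntervalIntegrable (fun u => m ^ 2 / u * φa u ^ 2) volume 0 U →
      IntervalIntegrable (fun u => 4 * u * φb₁ u ^ 2) volume 0 U →
      IntervalIntegrable (fun u => m ^ 2 / u * φb u ^ 2) volume 0 U →
      IntervalIntegrable (fun u => u * a u ^ 2) volume 0 U →
      IntervalIntegrable (fun u => u * b u ^ 2) volume 0 U →
      IntervalIntegrable (fun u => b u * φa u - a u * φb u) volume 0 U →
      ∀ u ∈ Icc 0 U, (1 + u) ^ 4 * (a u ^ 2 + b u ^ 2) ≤ C * (1 + Real.log Rc) ^ 11 * Rc ^ 3 * M ^ 2 := by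
  -- ### constants depending on `γ, m` only (opaque names + defining equations; no `set`/`let`, to keep defeq checks cheap)
  have hπ : 0 < Real.pi := Real.pi_pos
  have hm0 : 0 < m := by linarith
  obtain ⟨a₂, ha₂⟩ : ∃ x : ℝ, x = 20 / m * (4 * Real.pi * (γ + 1) + 4) + 1 := ⟨_, rfl⟩
  obtain ⟨cφ, hcφ⟩ : ∃ x : ℝ, x = 12 * (2 * (1 + 36 * γ ^ 2) + 81 * γ / 32 + 81 / 64) := ⟨_, rfl⟩
  obtain ⟨a₁, ha₁⟩ : ∃ x : ℝ, x = γ + 12 * a₂ * cφ := ⟨_, rfl⟩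
  obtain ⟨a₃, ha₃⟩ : ∃ x : ℝ, x = 6 * (400 * Real.pi * (4 * Real.pi * (γ + 1) + 4) / m ^ 2 + 1 / 2) := ⟨_, rfl⟩
  obtain ⟨b₀, hb₀⟩ : ∃ x : ℝ, x = 9600 * Real.pi ^ 2 / m ^ 2 := ⟨_, rfl⟩
  obtain ⟨f₀, hf₀⟩ : ∃ x : ℝ, x = 3 * (16 * cφ / γ ^ 2 + 243 / 8) := ⟨_, rfl⟩
  obtain ⟨sS, hsS⟩ : ∃ x : ℝ, x = 6 * a₁ * b₀ + 6 * a₃ + 2 * (240 * Real.pi * a₁ * f₀ / m + 120 * a₁ / m ^ 2 + 3 * f₀ + a₂ / m) := ⟨_, rfl⟩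
  obtain ⟨tT, htT⟩ : ∃ x : ℝ, x = a₃ + a₂ * f₀ + 3 * a₂ * cφ * sS + a₂ / m + γ ^ 2 * a₂ * sS / m := ⟨_, rfl⟩
  obtain ⟨Kc, hKc⟩ : ∃ x : ℝ, x = 16 * tT + 16 * (16 / γ ^ 2 + sS) := ⟨_, rfl⟩
  have ha₂0 : 0 < a₂ := by rw [ha₂]; positivity
  have hcφ0 : 0 < cφ := by rw [hcφ]; positivity
  have ha₁0 : 0 < a₁ := by rw [ha₁]; positivity
  have ha₃0 : 0 < a₃ := by rw [ha₃]; positivity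
  have hb₀0 : 0 < b₀ := by rw [hb₀]; positivity
  have hf₀0 : 0 < f₀ := by rw [hf₀]; positivity
  have hsS0 : 0 < sS := by rw [hsS]; positivity
  have htT0 : 0 < tT := by rw [htT]; positivity
  have hKc0 : 0 ≤ Kc := by rw [hKc]; positivity
  obtain ⟨R₀, hR₀1, hR₀⟩ := twoZone_loop_large_three hγ hm ha₂ hcφ ha₁
  obtain ⟨R₁, hR₁1, hR₁⟩ := twoZone_absorb_small (Kc := Kc) hγ hm0 hKc0
  refine ⟨max R₀ R₁, 4 * Kc * (1 + 12 / γ) ^ 11, le_trans hR₀1 (le_max_left _ _), by positivity, ?_⟩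
  intro Rc ρ U M a a₁ b b₁ φa φa₁ φb φb₁ f₁ f₂ hRc hU hρ ha hb ha₁' hb₁' hφa hφb hf₁c hf₂c hΦac hΦbc hPac hPbc ha0 hb0 hφa0 hφb0
    hdera hderb hderφa hderφb hΦa hΦb hPa hPb hsuppa hsuppb hsuppφa hsuppφb hf₁ hf₂
    hIΩ hIE hIf hIg hID₁ hID₂ hIaφ hIbφ hIBa₁ hIBa₂ hIBb₁ hIBb₂ hIua hIub hIcross
  obtain ⟨hu₀64, hu₀1, hE, hsmall⟩ := hR₀ Rc (le_trans (le_max_left _ _) hRc)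
  have hKN := hR₁ Rc (le_trans (le_max_right _ _) hRc)
  have hRc1 : 1 ≤ Rc := le_trans hR₀1 (le_trans (le_max_left _ _) hRc)
  have hRc0 : 0 < Rc := by linarith only [hRc1]
  have hL0' : 0 ≤ Real.log Rc := Real.log_nonneg hRc1
  -- opaque names for `L = log Rc` and `u₀ = (12/γ)L`
  generalize hLdef : Real.log Rc = L at hu₀64 hu₀1 hE hsmall hKN hU hρ hL0' ⊢
  generalize hu₀def : 12 / γ * L = u₀ at hu₀64 hu₀1 hE hsmall hKN hU hρ
  have hu₀0 : 0 < u₀ := by linarith only [hu₀1]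
  have h3γ : 0 < 3 / γ := by positivity
  have hU0 : 0 < U := by linarith only [hU, hu₀0, h3γ]
  have hM0 : 0 ≤ M := le_trans (by positivity) (hf₁ 0 le_rfl)
  -- ### the source size `N := √S`, `S = max_{[0,U]} (1+u)⁴(a²+b²)`
  have hfc : ContinuousOn (fun u => (1 + u) ^ 4 * (a u ^ 2 + b u ^ 2)) (Icc 0 U) :=
    ((continuousOn_const.add (continuousOn_id' _)).pow 4).mul
      (((ha.mono (fun u hu => hu.1)).pow 2).add ((hb.mono (fun u hu => hu.1)).pow 2))
  obtain ⟨us, hus, hmax⟩ := isCompact_Icc.exists_isMaxOn (nonempty_Icc.2 hU0.le) hfc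
  obtain ⟨S, hSdef⟩ : ∃ x : ℝ, x = (1 + us) ^ 4 * (a us ^ 2 + b us ^ 2) := ⟨_, rfl⟩
  have hSmax : ∀ u ∈ Icc 0 U, (1 + u) ^ 4 * (a u ^ 2 + b u ^ 2) ≤ S := by
    intro u hu; rw [hSdef]; exact (isMaxOn_iff.mp hmax) u hu
  have hS0 : 0 ≤ S := by rw [hSdef]; have := hus.1; positivity
  obtain ⟨N, hNdef⟩ : ∃ x : ℝ, x = Real.sqrt S := ⟨_, rfl⟩
  have hN0 : 0 ≤ N := by rw [hNdef]; exact Real.sqrt_nonneg _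
  have hN2 : N ^ 2 = S := by rw [hNdef]; exact Real.sq_sqrt hS0
  have hSa : ∀ u ∈ Icc 0 U, (1 + u) ^ 4 * a u ^ 2 ≤ S := fun u hu =>
    le_trans (mul_le_mul_of_nonneg_left (le_add_of_nonneg_right (sq_nonneg (b u))) (pow_nonneg (by linarith only [hu.1]) 4)) (hSmax u hu)
  have hSb : ∀ u ∈ Icc 0 U, (1 + u) ^ 4 * b u ^ 2 ≤ S := fun u hu =>
    le_trans (mul_le_mul_of_nonneg_left (le_add_of_nonneg_left (sq_nonneg (a u))) (pow_nonneg (by linarith only [hu.1]) 4)) (hSmax u hu)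
  have hNa : ∀ u, 0 < u → u * |a u| ≤ N := by rw [hNdef]; exact source_le_sqrt_sup hSa hsuppa
  have hNb : ∀ u, 0 < u → u * |b u| ≤ N := by rw [hNdef]; exact source_le_sqrt_sup hSb hsuppb
  -- ### the abbreviations of the two-zone theorem (opaque names + equations)
  obtain ⟨Kb, hKb⟩ : ∃ x : ℝ, x = 2 * Real.pi * (u₀ + 2 / γ + 4 / γ) := ⟨_, rfl⟩
  obtain ⟨ME, hME⟩ : ∃ x : ℝ, x = M + γ ^ 2 * Rc / (8 * Real.pi * m) * ((1 + u₀) ^ 2 * Real.exp (-(γ * u₀ / 4))) * N := ⟨_, rfl⟩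
  obtain ⟨c₁, hc₁⟩ : ∃ x : ℝ, x = (1 - 16 / (5 * m ^ 2)) * m := ⟨_, rfl⟩
  obtain ⟨κ, hκ⟩ : ∃ x : ℝ, x = γ ^ 2 * Rc / (16 * Real.pi * m) := ⟨_, rfl⟩
  obtain ⟨A₁b, hA₁b⟩ : ∃ x : ℝ, x = (u₀ + 2 / γ) * Real.exp (γ * (u₀ + 2 / γ) / 4) / Rc * (4 * Kb * ((γ + 1) * Kb + 4) / c₁ ^ 2 + 1 / 2) :=
    ⟨_, rfl⟩
  obtain ⟨A₂b, hA₂b⟩ : ∃ x : ℝ, x = 4 * ((γ + 1) * Kb + 4) / c₁ := ⟨_, rfl⟩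
  obtain ⟨A₃b, hA₃b⟩ : ∃ x : ℝ, x = κ * (1 + A₂b) := ⟨_, rfl⟩
  obtain ⟨cΦ, hcΦ⟩ : ∃ x : ℝ, x = 12 * ((1 + 36 * γ ^ 2) * (u₀ + 3 / γ) + 81 * γ / 32 + 81 / 64) := ⟨_, rfl⟩
  obtain ⟨φ₁, hφ₁⟩ : ∃ x : ℝ, x = Real.exp (γ * (u₀ + 3 / γ) / 4) * cΦ := ⟨_, rfl⟩
  obtain ⟨φ₀, hφ₀⟩ : ∃ x : ℝ, x = Real.exp (γ * (u₀ + 3 / γ) / 4)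
      * (cΦ * (16 * ME ^ 2 / (γ ^ 2 * u₀ ^ 4)) + 243 / 8 * (ME ^ 2 / (1 + u₀) ^ 4)) := ⟨_, rfl⟩
  obtain ⟨ξ₁, hξ₁⟩ : ∃ x : ℝ, x = u₀ ^ 2 / 2 := ⟨_, rfl⟩
  obtain ⟨ξ₀, hξ₀⟩ : ∃ x : ℝ, x = 8 * ME ^ 2 / (γ ^ 2 * u₀ ^ 2) := ⟨_, rfl⟩
  obtain ⟨β₀, hβ₀⟩ : ∃ x : ℝ, x = Kb * (4 * Kb * (M ^ 2 * ((u₀ + 2 / γ) * Real.exp (γ * (u₀ + 2 / γ) / 4))) / (c₁ ^ 2 * Rc ^ 2)) :=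
    ⟨_, rfl⟩
  obtain ⟨β₁, hβ₁⟩ : ∃ x : ℝ, x = Kb * (4 / (c₁ * Rc)) := ⟨_, rfl⟩
  obtain ⟨β₂, hβ₂⟩ : ∃ x : ℝ, x = Kb * (4 * κ / (c₁ * Rc)) := ⟨_, rfl⟩
  obtain ⟨τ₀, hτ₀⟩ : ∃ x : ℝ, x = A₁b * M ^ 2 := ⟨_, rfl⟩
  obtain ⟨τ₁, hτ₁⟩ : ∃ x : ℝ, x = A₂b + 1 := ⟨_, rfl⟩
  obtain ⟨τ₂, hτ₂⟩ : ∃ x : ℝ, x = A₃b := ⟨_, rfl⟩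
  obtain ⟨e₁, he₁⟩ : ∃ x : ℝ, x = Real.exp (1 / 4) / Real.exp (γ * u₀ / 4) := ⟨_, rfl⟩
  obtain ⟨θ', hθ'⟩ : ∃ x : ℝ, x = (u₀ - 1 / γ) / (Real.exp 1 * (A₂b + 1) * cΦ) := ⟨_, rfl⟩
  obtain ⟨α₁, hα₁⟩ : ∃ x : ℝ, x = γ + 1 / θ' := ⟨_, rfl⟩
  obtain ⟨α₂, hα₂⟩ : ∃ x : ℝ, x = θ' / (4 * (u₀ - 1 / γ)) := ⟨_, rfl⟩
  obtain ⟨S₀, hS₀⟩ : ∃ x : ℝ, x = 2 * (e₁ * (α₁ * (β₀ + β₁ * φ₀ + β₂ * ξ₀) + α₂ * (τ₀ + τ₁ * φ₀ + τ₂ * ξ₀))) := ⟨_, rfl⟩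
  obtain ⟨Qb, hQb⟩ : ∃ x : ℝ, x = 16 * ME ^ 2 / γ ^ 2 + u₀ ^ 4 * S₀ := ⟨_, rfl⟩
  obtain ⟨Tb, hTb⟩ : ∃ x : ℝ, x = τ₀ + τ₁ * (φ₀ + φ₁ * S₀) + τ₂ * (ξ₀ + ξ₁ * S₀) := ⟨_, rfl⟩
  -- ### the loop condition, the two-zone theorem, the size of its constants
  obtain ⟨hθ0, hloop⟩ := twoZone_loop_reduction hγ hm hRc1 hu₀64 hu₀1 hKb hc₁ hκ hA₂b hcΦ hφ₁ hξ₁ hβ₁ hβ₂ hτ₁ (hτ₂.trans hA₃b) he₁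
    hα₁ hα₂ hθ' ha₂ hcφ ha₁ hsmall
  have h2z := twoZone_sup_le hγ hm hRc1 hu₀64 hu₀1 hU hθ0 hρ ha hb ha₁' hb₁' hφa hφb hf₁c hf₂c hΦac hΦbc hPac hPbc ha0 hb0 hφa0 hφb0
    hdera hderb hderφa hderφb hΦa hΦb hPa hPb hsuppa hsuppb hsuppφa hsuppφb hf₁ hf₂ hNa hNb
    hIΩ hIE hIf hIg hID₁ hID₂ hIaφ hIbφ hIBa₁ hIBa₂ hIBb₁ hIBb₂ hIua hIub hIcross
    hKb hME hc₁ hκ hA₁b hA₂b hA₃b hcΦ hφ₁ hφ₀ hξ₁ hξ₀ hβ₀ hβ₁ hβ₂ hτ₀ hτ₁ hτ₂ he₁ hα₁ hα₂ hloop hS₀ hQb hTb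
  have hF := twoZone_constants_le hγ hm hRc1 hu₀64 hu₀1 hM0 hN0 hE hKb hME hc₁ hκ hA₁b hA₂b hA₃b hcΦ hφ₁ hφ₀ hξ₁ hξ₀ hβ₀ hβ₁ hβ₂
    hτ₀ hτ₁ hτ₂ he₁ hα₁ hα₂ hθ' hS₀ hQb hTb ha₂ hcφ ha₁ ha₃ hb₀ hf₀ hsS htT hKc
  -- ### absorption of `N² = S`
  generalize hgdef : γ ^ 2 * Rc / (8 * Real.pi * m) * ((1 + u₀) ^ 2 * Real.exp (-(γ * u₀ / 4))) = g at hKN hME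
  generalize hWdef : Kc * (1 + u₀) ^ 11 * Rc ^ 3 = W at hKN hF
  have hg0 : 0 ≤ g := by rw [← hgdef]; positivity
  have hW0 : 0 ≤ W := by rw [← hWdef]; positivity
  have hME2 : ME ^ 2 ≤ 2 * M ^ 2 + 2 * g ^ 2 * N ^ 2 := by
    rw [hME]; nlinarith only [sq_nonneg (M - g * N)]
  have hSle : S ≤ 2 * W * M ^ 2 + S / 2 := by
    have h2 : S ≤ W * ME ^ 2 := by
      have := h2z us hus
      rw [← hSdef] at this
      exact this.trans hF
    have h4 : W * ME ^ 2 ≤ W * (2 * M ^ 2 + 2 * g ^ 2 * N ^ 2) := mul_le_mul_of_nonneg_left hME2 hW0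
    have h5 : W * (2 * M ^ 2 + 2 * g ^ 2 * N ^ 2) = 2 * W * M ^ 2 + (2 * W * g ^ 2) * S := by rw [hN2]; ring
    have h6 : (2 * W * g ^ 2) * S ≤ 1 / 2 * S := mul_le_mul_of_nonneg_right hKN hS0
    linarith only [h2, h4, h5, h6]
  have hSfin : S ≤ 4 * W * M ^ 2 := by linarith only [hSle]
  -- ### conclusion
  have h12 : 0 ≤ 12 / γ := by positivity
  have hP : (1 + u₀) ^ 11 ≤ (1 + 12 / γ) ^ 11 * (1 + L) ^ 11 := by
    rw [← mul_pow]
    apply pow_le_pow_left₀ (by linarith only [hu₀0])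
    rw [← hu₀def]
    nlinarith only [hL0', h12]
  intro u hu
  have h1 := (hSmax u hu).trans hSfin
  have h2 : 4 * W * M ^ 2 ≤ 4 * Kc * (1 + 12 / γ) ^ 11 * (1 + L) ^ 11 * Rc ^ 3 * M ^ 2 := by
    rw [← hWdef]
    have h3 : Kc * (1 + u₀) ^ 11 ≤ Kc * ((1 + 12 / γ) ^ 11 * (1 + L) ^ 11) := mul_le_mul_of_nonneg_left hP hKc0
    have h4 := mul_le_mul_of_nonneg_right (mul_le_mul_of_nonneg_right h3 (pow_nonneg hRc0.le 3)) (sq_nonneg M)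
    linarith only [h4]
  exact h1.trans h2

end Summit.NavierStokesRegularity.NavierStokesRegularity.Theorems.DefectColumnGate

end
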